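import Summits.QuantumFields.YangMills.Theorems.LuscherReductionTwistedTraceScalingBOAssemblyFloor
import Summits.QuantumFields.YangMills.Theorems.LuscherReductionTwistedTraceScalingBOTransport
import Summits.QuantumFields.YangMills.Theorems.LuscherReductionTwistedTraceScalingBTProductForm
import HarnessLib

/-!
# (C4) normalisations: `‖φ⊗Ω‖²_w` from below, the (B-T) kernel at the vacuum pair as a fibre integral of the central transfer, and its quasimode floor
# (lane A of S-BASE, crux `TwistedTraceScaling` stmt-QuantumFields-20203, C4-CORE, the (OD) pen; `pub/ym-fleet/ym-luscher-20007-p1/HANDOFF-g19.md` steps (2)–(3))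

The (B-OD) constant `b` is the `L²(w)` defect divided by `σ·μ₀·‖φ⊗Ω‖_w` with the (B-T) factor `σ = btC/(fpZ·γ)`, `btC = fpBOKernel(Ω,W)(1,1)/K₁(1,1)`.  Two normalisations:
* §1 ★ `tubeNormSq_boFun_ge` — `‖boFun φ Ω‖²_w ≥ Γ·∫φ²` when `fibreMass ≥ Γ` on `𝒰 ⊇ supp φ` (twin of `…BOAssemblyFloor.tubeNormSq_boFun_le`; with (B-N) this is
  `‖φ⊗Ω‖²_w ≥ (1−κ)γ·∫φ²`);
* §2 ★ `fpBOKernel_eq_integral_fpFibreTransfer` — `fpBOKernel β Ω W u u' = ∫_v Ω(v̂)·fpFibreTransfer β Ω W (oT u v) u' dπ(v)` (Fubini); in particular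
  `fpBOKernel(1,1) = ∫ Ω(v̂)·T₁(v) dπ`, `T₁(v) = fpFibreTransfer β Ω W (oT 1 v) 1` the central transfer of (C1);
* §3 ★★ `fpBOKernel_one_one_ge_of_quasimode` — if `Ω, W ≥ 0` and `T₁ ≥ c·A` on a set `V_in` of fibre directions (`A ≥ 0`, `c ≥ 0`; the LOWER half of the central
  quasimode), then `fpBOKernel(1,1) ≥ c·∫ 𝟙_{V_in}·Ω(v̂)·A(v) dπ` — so `btC` is bounded BELOW by the inner Gaussian fibre mass, and `b` carries the ratio
  (whole-ball mass)/(inner mass) (`…BOFibreBall` gives the polynomial floor of the inner mass).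
HONEST FRAMING: bookkeeping for a stub of a child of the CONDITIONAL route R2b1; the mass ratio, (C5), the final `b`, (B-ST), C4-CORE OPEN; not a gap, not Clay.
-/

set_option autoImplicit false

noncomputable section

open MeasureTheory Filter Topology Real
open scoped BigOperators
open Literature.MathematicalPhysics.QuantumFieldTheory
open Literature.MathematicalPhysics.QuantumLattice

namespace Summit.QuantumFields.YangMills.Theorems.FemtoTransferGap.TwoLattice.ConstTube

open Summit.QuantumFields.YangMills.Theorems.FemtoTransferGap
open Summit.QuantumFields.YangMills.Theorems.FemtoTransferGap.TwoLattice
open Summit.QuantumFields.YangMills.Theorems.FemtoTransferGap.TwoLattice.Avg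
open Summit.QuantumFields.YangMills.Theorems.FemtoTransferGap.TwoLattice.Stiff (LinkSpace)

variable {L : ℕ} [NeZero L]

/-! ## §1 ★ The weighted norm of a BO function from below -/

/-- ★ `‖boFun φ Ω‖²_w ≥ Γ·∫φ²` when `fibreMass ≥ Γ` on `𝒰 ⊇ supp φ`. [folklore] -/
theorem tubeNormSq_boFun_ge {φ : GaugeConfig 3 1 SU2 → ℝ} (hφ : Measurable φ) {Cφ : ℝ} (hCφ : ∀ u, |φ u| ≤ Cφ) {Ω : LinkSpace L → ℝ} (hΩ : Measurable Ω) {CΩ : ℝ}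
    (hCΩ : ∀ x, |Ω x| ≤ CΩ) {w : GaugeConfig 3 L SU2 → ℝ} (hw : Measurable w) {Cw : ℝ} (hCw : ∀ U, |w U| ≤ Cw) {𝒰 : Set (GaugeConfig 3 1 SU2)}
    (hφs : ∀ u, φ u ≠ 0 → u ∈ 𝒰) {Γ : ℝ} (hΓ : ∀ u ∈ 𝒰, Γ ≤ fibreMass L w Ω u) :
    Γ * ∫ u, φ u ^ 2 ∂configMeasure SU2 1 ≤ tubeNormSq w (boFun L φ Ω) := by
  haveI := isFiniteMeasure_orthoTransverse L
  rw [tubeNormSq_boFun hφ hCφ hΩ hCΩ hw hCw, ← integral_const_mul]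
  have hCΩ0 : 0 ≤ CΩ := (abs_nonneg _).trans (hCΩ 0)
  have hM := measurable_fibreMass hw hΩ (L := L)
  have hMb : ∀ u, |fibreMass L w Ω u| ≤ CΩ ^ 2 * Cw * (orthoTransverse L).real Set.univ := fun u => by
    unfold fibreMass
    calc |∫ v, Ω (linkEmbed L v) ^ 2 * w (orthoTube L u v) ∂orthoTransverse L| ≤ ∫ v, |Ω (linkEmbed L v) ^ 2 * w (orthoTube L u v)| ∂orthoTransverse L :=
          abs_integral_le_integral_abs
      _ ≤ ∫ _v, CΩ ^ 2 * Cw ∂orthoTransverse L := by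
          refine integral_mono_of_nonneg (ae_of_all _ fun v => abs_nonneg _) (integrable_const _) (ae_of_all _ fun v => ?_)
          show |Ω (linkEmbed L v) ^ 2 * w (orthoTube L u v)| ≤ CΩ ^ 2 * Cw
          rw [abs_mul, abs_pow]
          exact mul_le_mul (pow_le_pow_left₀ (abs_nonneg _) (hCΩ _) 2) (hCw _) (abs_nonneg _) (by positivity)
      _ = CΩ ^ 2 * Cw * (orthoTransverse L).real Set.univ := by rw [integral_const, smul_eq_mul, mul_comm]
  have hiL : Integrable (fun u => φ u ^ 2 * fibreMass L w Ω u) (configMeasure SU2 1) :=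
    integrable_of_measurable_abs_le _ ((hφ.pow_const 2).mul hM) (C := Cφ ^ 2 * (CΩ ^ 2 * Cw * (orthoTransverse L).real Set.univ)) fun u => by
      rw [abs_mul, abs_pow]; exact mul_le_mul (pow_le_pow_left₀ (abs_nonneg _) (hCφ u) 2) (hMb u) (abs_nonneg _) (by positivity)
  have hiR : Integrable (fun u => Γ * φ u ^ 2) (configMeasure SU2 1) :=
    (integrable_of_measurable_abs_le _ (hφ.pow_const 2) (C := Cφ ^ 2) fun u => by rw [abs_pow]; exact pow_le_pow_left₀ (abs_nonneg _) (hCφ u) 2).const_mul _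
  refine integral_mono hiR hiL fun u => ?_
  dsimp only
  by_cases hu : u ∈ 𝒰
  · have := hΓ u hu; nlinarith [sq_nonneg (φ u)]
  · have h0 : φ u = 0 := by by_contra h; exact hu (hφs u h)
    rw [h0]; simp

/-! ## §2 ★ The (B-T) kernel as a fibre integral of the one-sided fibre transfer -/

/-- The `v`-slice of the product integrand of `fpBOKernel` integrates to `Ω(v̂)·fpFibreTransfer β Ω W (oT u v) u'`. [folklore] -/
theorem integral_fpTriple_slice (β : ℝ) (Ω : LinkSpace L → ℝ) (W : (Site 3 L → SU2) → ℝ) (u u' : GaugeConfig 3 1 SU2) (v : Edge 3 L → Fin 3 → ℝ) :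
    ∫ q, fpTriple L β Ω W u u' (v, q) ∂(orthoTransverse L).prod (gaugeMeasure L) = Ω (linkEmbed L v) * fpFibreTransfer L β Ω W (orthoTube L u v) u' := by
  unfold fpFibreTransfer fpTriple
  rw [← integral_const_mul]

/-- ★ **`fpBOKernel β Ω W u u' = ∫_v Ω(v̂)·fpFibreTransfer β Ω W (oT u v) u' dπ(v)`** (bounded measurable `Ω, W`; Fubini on `π ⊗ (π ⊗ dg)`), and the `v`-integrand is
integrable. [folklore] -/
theorem fpBOKernel_eq_integral_fpFibreTransfer (β : ℝ) {Ω : LinkSpace L → ℝ} (hΩm : Measurable Ω) {CΩ : ℝ} (hCΩ : ∀ x, |Ω x| ≤ CΩ)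
    {W : (Site 3 L → SU2) → ℝ} (hW : Measurable W) {CW : ℝ} (hCW : ∀ g, |W g| ≤ CW) (u u' : GaugeConfig 3 1 SU2) :
    Integrable (fun v => Ω (linkEmbed L v) * fpFibreTransfer L β Ω W (orthoTube L u v) u') (orthoTransverse L) ∧
      fpBOKernel L β Ω W u u' = ∫ v, Ω (linkEmbed L v) * fpFibreTransfer L β Ω W (orthoTube L u v) u' ∂orthoTransverse L := by
  haveI := isFiniteMeasure_orthoTransverse L
  obtain ⟨B, hB⟩ := abs_fpTriple_le (L := L) β hCΩ hCW u u'
  have hint : Integrable (fpTriple L β Ω W u u') ((orthoTransverse L).prod ((orthoTransverse L).prod (gaugeMeasure L))) :=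
    integrable_of_measurable_abs_le _ (measurable_fpTriple β hΩm hW u u') hB
  have e : (fun v => Ω (linkEmbed L v) * fpFibreTransfer L β Ω W (orthoTube L u v) u') =
      fun v => ∫ q, fpTriple L β Ω W u u' (v, q) ∂(orthoTransverse L).prod (gaugeMeasure L) := funext fun v => (integral_fpTriple_slice β Ω W u u' v).symm
  refine ⟨?_, ?_⟩
  · rw [e]; exact hint.integral_prod_left
  · rw [fpBOKernel_eq_integral_prod β hΩm hCΩ hW hCW, integral_prod _ hint, e]

/-! ## §3 ★★ The quasimode floor of the (B-T) kernel at the vacuum pair -/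

/-- ★★ **`fpBOKernel(1,1) ≥ c·∫ 𝟙_{V_in}·Ω·A dπ`** when `Ω, W ≥ 0` (bounded measurable), `A` measurable bounded, `V_in` measurable, and the central transfer
obeys the lower quasimode bound `c·A(v) ≤ fpFibreTransfer β Ω W (oT 1 v) 1` for `v ∈ V_in` (no sign conditions on `A`, `c` are needed). [cite: Luscher1983, §3] -/
theorem fpBOKernel_one_one_ge_of_quasimode (β : ℝ) {Ω : LinkSpace L → ℝ} (hΩm : Measurable Ω) {CΩ : ℝ} (hCΩ : ∀ x, |Ω x| ≤ CΩ) (hΩ0 : ∀ x, 0 ≤ Ω x)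
    {W : (Site 3 L → SU2) → ℝ} (hW : Measurable W) {CW : ℝ} (hCW : ∀ g, |W g| ≤ CW) (hW0 : ∀ g, 0 ≤ W g)
    {A : (Edge 3 L → Fin 3 → ℝ) → ℝ} (hAm : Measurable A) {CA : ℝ} (hCA : ∀ v, |A v| ≤ CA) {c : ℝ}
    {Vin : Set (Edge 3 L → Fin 3 → ℝ)} (hVin : MeasurableSet Vin)
    (hlo : ∀ v ∈ Vin, c * A v ≤ fpFibreTransfer L β Ω W (orthoTube L 1 v) 1) :
    c * ∫ v, Vin.indicator (fun _ => (1 : ℝ)) v * (Ω (linkEmbed L v) * A v) ∂orthoTransverse L ≤ fpBOKernel L β Ω W 1 1 := by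
  haveI := isFiniteMeasure_orthoTransverse L
  obtain ⟨hiU, hK⟩ := fpBOKernel_eq_integral_fpFibreTransfer β hΩm hCΩ hW hCW (1 : GaugeConfig 3 1 SU2) 1
  rw [hK, ← integral_const_mul]
  have hCΩ0 : 0 ≤ CΩ := (abs_nonneg _).trans (hCΩ 0)
  have hiL : Integrable (fun v => c * (Vin.indicator (fun _ => (1 : ℝ)) v * (Ω (linkEmbed L v) * A v))) (orthoTransverse L) := by
    refine (integrable_of_measurable_abs_le _ ((measurable_const.indicator hVin).mul ((hΩm.comp (measurable_linkEmbed L)).mul hAm)) (C := 1 * (CΩ * CA))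
      fun v => ?_).const_mul c
    show |Vin.indicator (fun _ => (1 : ℝ)) v * (Ω (linkEmbed L v) * A v)| ≤ 1 * (CΩ * CA)
    rw [abs_mul, abs_mul]
    refine mul_le_mul ?_ (mul_le_mul (hCΩ _) (hCA _) (abs_nonneg _) hCΩ0) (mul_nonneg (abs_nonneg _) (abs_nonneg _)) zero_le_one
    by_cases h : v ∈ Vin
    · rw [Set.indicator_of_mem h, abs_one]
    · rw [Set.indicator_of_notMem h, abs_zero]; exact zero_le_one
  have hT0 : ∀ v, 0 ≤ fpFibreTransfer L β Ω W (orthoTube L 1 v) 1 := fun v => fpFibreTransfer_nonneg β hΩ0 hW0 _ _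
  refine integral_mono hiL hiU fun v => ?_
  dsimp only
  by_cases h : v ∈ Vin
  · rw [Set.indicator_of_mem h, one_mul]
    calc c * (Ω (linkEmbed L v) * A v) = Ω (linkEmbed L v) * (c * A v) := by ring
      _ ≤ Ω (linkEmbed L v) * fpFibreTransfer L β Ω W (orthoTube L 1 v) 1 := mul_le_mul_of_nonneg_left (hlo v h) (hΩ0 _)
  · rw [Set.indicator_of_notMem h, zero_mul, mul_zero]
    exact mul_nonneg (hΩ0 _) (hT0 v)

end Summit.QuantumFields.YangMills.Theorems.FemtoTransferGap.TwoLattice.ConstTube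

end
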